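import Literature.Computability.Complexity.AdaptiveFunctions
import Literature.Computability.Cryptography.OracleGames
import HarnessLib

/-!
# PPT oracle adversaries from adaptive oracle transducers: the `SampBPP^A` machine `r ↦ adFn Q q G A ⟨x, r⟩`

Layer `Literature/Computability/Cryptography`, a bridge between the adaptive oracle transducers of
`Complexity/AdaptiveFunctions.lean` (`adFnAlg Q q G`: ask `Q ⟨w, answer bits⟩` for `q(|w|)` rounds,
then output `G ⟨w, answer bits⟩`; one transcript machine for ALL oracles) and the C4a ORACLE
ADVERSARY of `OracleGames.lean` (a transcript machine with polynomial coin and round budgets read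
in the length of the game input `x`, run on `w = ⟨x, r⟩` with uniform coins `r`; output law
`OracleAdversary.outputPMF` — the machines of the sampling class `SampBPP^O`,
`Literature.Barriers.QuantumAdvantage.SampPRel`). For `Q, G` and a coin polynomial `co`:

* `adSampler Q q G co` — the adversary with algorithm `adFnAlg Q q G`, `co(|x|)` coins and round
  budget `q(2|x| + 2 + co|x|) + 1` (one more than the rounds the transducer needs on the machine
  input `⟨x, r⟩`, of length `2|x| + 2 + co(|x|)`);
* `isPPT_adSampler` — it is PPT when `Q, G ∈ FP` (`isPolyTime_adFnAlg`);
* `run_adSampler` — on `⟨x, r⟩`, `|r| = co(|x|)`, against ANY language oracle `A` it outputs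
  `adFn Q q G A ⟨x, r⟩` within its budget (`run_adFnAlg`);
* **`outputPMF_adSampler`**, **`map_getD_outputPMF_adSampler`** — hence its output law at `A` on
  `x` is the push-forward of the uniform coins `r ∈ {0,1}^{co |x|}` under
  `r ↦ adFn Q q G A ⟨x, r⟩` (no run is cut off, so reading a missing output as `ε` changes
  nothing).

This is the routine "a probabilistic polynomial-time oracle machine is a deterministic one reading
its coins from the input" (Arora–Barak 2009, Def. 7.1 with §3.4; Goldreich 2001, Def. 3.6.4) for
machines presented by a query generator and an output map; consumer: the `SampBPP^{TQBF,O}`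
simulator of Aaronson–Chen 2017, Lemma 5.3 (`Literature/Barriers/QuantumAdvantage/`).

## References

* S. Arora, B. Barak, *Computational Complexity: A Modern Approach*, CUP 2009, Def. 7.1 and the
  remark after it, §3.4 (oracle machines) [AroraBarak2009].
* O. Goldreich, *Foundations of Cryptography I*, CUP 2001, §3.6, Def. 3.6.4 (probabilistic
  polynomial-time oracle machines) [Goldreich2001].
* R. E. Ladner, N. A. Lynch, A. L. Selman, Theoret. Comput. Sci. 1 (1975), §2 [LadnerLynchSelman1975].
-/

noncomputable section

namespace Literature.Computability.Cryptography

open _root_.Computability Polynomial Complexity Complexity.AdQuery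

variable {Q : List Bool → List Bool} {q : Polynomial ℕ} {G : List Bool → List Bool} {co : Polynomial ℕ}

section Defs

variable (Q q G co)

/-- **The sampler adversary of an adaptive oracle transducer**: algorithm `adFnAlg Q q G`, `co(|x|)`
coins, round budget `q(2|x| + 2 + co|x|) + 1` on game inputs of length `|x|` (the transducer run on
`⟨x, r⟩`, `|⟨x, r⟩| = 2|x| + 2 + co(|x|)`, needs `q(|⟨x, r⟩|)` query rounds and one output round).
[cite: AroraBarak2009, Def. 7.1 with §3.4] -/
def adSampler : OracleAdversary (List Bool) where
  alg := adFnAlg Q q G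
  coins := co
  fuel := q.comp (2 * X + 2 + co) + 1

end Defs

/-- The sampler adversary is PPT for `Q, G ∈ FP`. [cite: AroraBarak2009, Def. 7.1 with §3.4] -/
theorem isPPT_adSampler (hQ : Q ∈ FP) (hG : G ∈ FP) : (adSampler Q q G co).IsPPT (encodingList Bool) :=
  isPolyTime_adFnAlg hQ hG

/-- The round budget on `x` exceeds the rounds needed on `⟨x, r⟩` when `|r| = co(|x|)`. [folklore] -/
theorem fuel_adSampler_eval (x r : List Bool) (hr : r.length = co.eval x.length) :
    (adSampler Q q G co).fuel.eval x.length = q.eval (boolPair x r).length + 1 := by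
  simp [adSampler, Polynomial.eval_comp, length_boolPair, hr]

/-- **The run of the sampler adversary**: on `⟨x, r⟩` with `|r| = co(|x|)`, against every language
oracle `A`, it outputs `adFn Q q G A ⟨x, r⟩` within its round budget. [cite: LadnerLynchSelman1975, §2] -/
theorem run_adSampler (A : Language Bool) (x r : List Bool) (hr : r.length = co.eval x.length) :
    (adSampler Q q G co).alg.run (Oracle.ofLanguage A) ((adSampler Q q G co).fuel.eval x.length)
        (boolPair x r) = some (adFn Q q G A (boolPair x r)) := by
  rw [fuel_adSampler_eval x r hr]
  exact run_adFnAlg A _ (Nat.lt_succ_self _)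

/-- **The output law of the sampler adversary** at a language oracle `A` on `x`: the push-forward of
the uniform coins `r ∈ {0,1}^{co |x|}` under `r ↦ some (adFn Q q G A ⟨x, r⟩)`.
[cite: AroraBarak2009, Def. 7.1 with §3.4] -/
theorem outputPMF_adSampler (A : Language Bool) (x : List Bool) :
    (adSampler Q q G co).outputPMF (Oracle.ofLanguage A) x =
      (PMF.uniformOfFintype (List.Vector Bool (co.eval x.length))).map
        fun r => some (adFn Q q G A (boolPair x r.toList)) := by
  rw [OracleAdversary.outputPMF_eq_map]
  refine congrArg (fun f : List.Vector Bool (co.eval x.length) → Option (List Bool) =>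
    PMF.map f (PMF.uniformOfFintype (List.Vector Bool (co.eval x.length)))) (funext fun r => ?_)
  exact run_adSampler A x r.toList (by simp [adSampler])

/-- **The output law read as strings** (a missing output read as `ε`, the convention of `SampBPP^O`):
the push-forward of the uniform coins under `r ↦ adFn Q q G A ⟨x, r⟩`. [cite: AroraBarak2009, Def. 7.1 with §3.4] -/
theorem map_getD_outputPMF_adSampler (A : Language Bool) (x : List Bool) :
    ((adSampler Q q G co).outputPMF (Oracle.ofLanguage A) x).map (fun o => o.getD []) =
      (PMF.uniformOfFintype (List.Vector Bool (co.eval x.length))).map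
        fun r => adFn Q q G A (boolPair x r.toList) := by
  rw [outputPMF_adSampler, PMF.map_comp]
  rfl

end Literature.Computability.Cryptography

end
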